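import Summits.HubbardSuperconductivity.HubbardSuperconductivity.Theses.AposterioriCapRg
import Literature.MathematicalPhysics.QuantumLattice.ShellGeometryStability

/-!
# Stub `stub_shellGeometryStable` of line `strict-continuum-certificate-transfer`
# (crux `CapRgSymmetricCertificatePinned`, item stmt-HubbardSuperconductivity-14045, route AposterioriCapRg)

`C²` truncation stability of the shell geometry: if the band
`e_∞(p) = -2(cos p₁ + cos p₂) - μ - Σ'_{m,n} κ_{mn} h_{mn}(p)` of a coefficient table with
`Σ (1+m+n)² |κ_{mn}| < ∞` satisfies `ShellGeometry` with margins `ε` on the wider shell `|e_∞| ≤ Λ + ε`,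
then the bands `renormalisedBandC μ ⟨d, κ⟩` of all sufficiently high truncations satisfy
`ShellGeometry` with the un-margined constants on the shell `|e_d| ≤ Λ`.

Proof: the truncations are the bands of the truncated tables `κ·1_{m,n ≤ d}`, which converge to `κ`
in the weighted `ℓ¹` distance (tail of a summable series); by
`Literature.MathematicalPhysics.QuantumLattice.tendsto_band_jets` the band, `gradSq` and
`levelCurvature` converge locally uniformly (`atTop ×ˢ 𝓝 p₀`), the strict margins absorb the error at
every point of the compact square `[-π, π]²`, and compactness makes the threshold uniform.
-/

noncomputable section

namespace Summit.HubbardSuperconductivity.CapRgSymmetricCertificatePinned.StrictContinuum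

open Filter Topology
open Literature.MathematicalPhysics.QuantumLattice Literature.Probability.LatticeModels
open scoped BigOperators

/-- **Compactness makes a locally eventual property uniformly eventual** (general-filter form of
`IsCompact.eventually_forall_of_forall_eventually`): if for every `y` in a compact `K` the property
holds eventually along `l ×ˢ 𝓝 y`, then eventually along `l` it holds at every point of `K`. -/
theorem eventually_forall_of_forall_eventually_prod {X Y : Type*} [TopologicalSpace Y] {l : Filter X}
    {K : Set Y} (hK : IsCompact K) {P : X × Y → Prop} (hP : ∀ y ∈ K, ∀ᶠ z in l ×ˢ 𝓝 y, P z) :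
    ∀ᶠ x in l, ∀ y ∈ K, P (x, y) := by
  simp only [← eventually_iSup, ← hK.prod_nhdsSet_eq_biSup] at hP
  exact hP.curry.mono fun _ h => h.self_of_nhdsSet

/-- **The squares `{0,…,d}²` exhaust `ℕ × ℕ`** (as a sequence tending to `atTop` in `Finset (ℕ × ℕ)`). -/
theorem tendsto_range_prod_range_atTop :
    Tendsto (fun d : ℕ => Finset.range (d + 1) ×ˢ Finset.range (d + 1)) atTop atTop := by
  refine Monotone.tendsto_atTop_atTop (fun a b hab => Finset.product_subset_product
    (Finset.range_subset_range.2 (by omega)) (Finset.range_subset_range.2 (by omega))) fun s => ?_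
  refine ⟨s.sup fun q => max q.1 q.2, fun q hq => ?_⟩
  have h := Finset.le_sup (f := fun q : ℕ × ℕ => max q.1 q.2) hq
  simp only [Finset.mem_product, Finset.mem_range]
  constructor <;> omega

/-- **Stub `stub_shellGeometryStable`** (`C²` truncation stability of the shell geometry): if the band of
the full `(1+m+n)²`-summable coefficient table satisfies `ShellGeometry` with margins `ε` (on the wider
shell `Λ + ε`), then every sufficiently high truncation `K_d = ⟨d, κ⟩` satisfies `ShellGeometry` with the
un-margined constants on the shell `Λ`. -/
theorem stub_shellGeometryStable : ∀ (μ Λ ε v₁ v₂ κ₁ κ₂ dv : ℝ) (κ : ℕ → ℕ → ℝ),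
    Summable (fun q : ℕ × ℕ => (1 + q.1 + q.2 : ℝ) ^ 2 * |κ q.1 q.2|) → 0 < ε → 0 ≤ v₁ → ε ≤ v₂ → 0 ≤ dv →
    ShellGeometry (fun p : Fin 2 → ℝ => -2 * (Real.cos (p 0) + Real.cos (p 1)) - μ -
        ∑' q : ℕ × ℕ, κ q.1 q.2 * TrigPolyC4v.harmonic q.1 q.2 p)
      (Λ + ε) (v₁ + ε) (v₂ - ε) (κ₁ + ε) (κ₂ - ε) (dv + ε) →
    ∀ᶠ d : ℕ in atTop, ShellGeometry (renormalisedBandC μ ⟨d, κ⟩) Λ v₁ v₂ κ₁ κ₂ dv := by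
  intro μ Λ ε v₁ v₂ κ₁ κ₂ dv κ hκ hε hv₁ hv₂ hdv H
  -- the truncated tables `cT d = κ · 1_{square d}` and their bands
  obtain ⟨cT, hcT⟩ : ∃ cT : ℕ → ℕ × ℕ → ℝ,
      ∀ d q, cT d q = if q ∈ Finset.range (d + 1) ×ˢ Finset.range (d + 1) then κ q.1 q.2 else 0 :=
    ⟨_, fun _ _ => rfl⟩
  have hcT0 : ∀ d, ∀ q ∉ Finset.range (d + 1) ×ˢ Finset.range (d + 1), cT d q = 0 := fun d q hq => by
    rw [hcT, if_neg hq]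
  have hsT : ∀ d, Summable fun q : ℕ × ℕ => ((1 : ℝ) + q.1 + q.2) ^ 2 * |cT d q| := fun d =>
    summable_of_ne_finset_zero (s := Finset.range (d + 1) ×ˢ Finset.range (d + 1)) fun q hq => by
      rw [hcT0 d q hq, abs_zero, mul_zero]
  have hband : ∀ d, renormalisedBandC μ ⟨d, κ⟩ = fun p : Fin 2 → ℝ =>
      -2 * (Real.cos (p 0) + Real.cos (p 1)) - μ - ∑' q : ℕ × ℕ, cT d q * TrigPolyC4v.harmonic q.1 q.2 p := by
    intro d; funext p
    simp only [renormalisedBandC, TrigPolyC4v.eval]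
    congr 1
    rw [tsum_eq_sum (s := Finset.range (d + 1) ×ˢ Finset.range (d + 1))
      (fun q hq => by rw [hcT0 d q hq, zero_mul]), Finset.sum_product]
    refine Finset.sum_congr rfl fun m hm => Finset.sum_congr rfl fun n hn => ?_
    rw [hcT, if_pos (Finset.mem_product.2 ⟨hm, hn⟩)]
  -- the tail `Σ_{q ∉ square d} (1+q₁+q₂)² |κ q| → 0`
  have htail : Tendsto (fun d => ∑' q : ℕ × ℕ, ((1 : ℝ) + q.1 + q.2) ^ 2 * |κ q.1 q.2 - cT d q|)
      atTop (𝓝 0) := by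
    set f : ℕ × ℕ → ℝ := fun q => ((1 : ℝ) + q.1 + q.2) ^ 2 * |κ q.1 q.2| with hf
    have hsplit : ∀ d, ∑' q : ℕ × ℕ, ((1 : ℝ) + q.1 + q.2) ^ 2 * |κ q.1 q.2 - cT d q| =
        ∑' q, f q - ∑ q ∈ Finset.range (d + 1) ×ˢ Finset.range (d + 1), f q := by
      intro d
      set s := Finset.range (d + 1) ×ˢ Finset.range (d + 1) with hs
      have hg : ∀ q, ((1 : ℝ) + q.1 + q.2) ^ 2 * |κ q.1 q.2 - cT d q| = if q ∈ s then 0 else f q := by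
        intro q
        by_cases hq : q ∈ s
        · rw [if_pos hq, hcT, if_pos hq, sub_self, abs_zero, mul_zero]
        · rw [if_neg hq, hcT0 d q hq, sub_zero]
      have h1 : Summable fun q => if q ∈ s then f q else 0 :=
        summable_of_ne_finset_zero (s := s) fun q hq => if_neg hq
      have h2 : Summable fun q => if q ∈ s then 0 else f q :=
        hκ.of_nonneg_of_le (fun q => by positivity) fun q => by
          split_ifs
          · positivity
          · exact le_rfl
      have h3 : ∑' q, (if q ∈ s then f q else 0) = ∑ q ∈ s, f q := by
        rw [tsum_eq_sum (s := s) (fun q hq => if_neg hq)]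
        exact Finset.sum_congr rfl fun q hq => if_pos hq
      simp_rw [hg]
      rw [eq_sub_iff_add_eq, ← h3, add_comm, ← h1.tsum_add h2]
      exact tsum_congr fun q => by split_ifs <;> simp
    simp_rw [hsplit]
    have hlim : Tendsto (fun d => ∑ q ∈ Finset.range (d + 1) ×ˢ Finset.range (d + 1), f q) atTop
        (𝓝 (∑' q, f q)) := hκ.hasSum.comp tendsto_range_prod_range_atTop
    simpa using (tendsto_const_nhds (x := ∑' q, f q)).sub hlim
  -- the compact square
  have hK : IsCompact {p : Fin 2 → ℝ | ∀ i, |p i| ≤ Real.pi} := by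
    have : {p : Fin 2 → ℝ | ∀ i, |p i| ≤ Real.pi} = Set.pi Set.univ fun _ => Set.Icc (-Real.pi) Real.pi := by
      ext p; simp only [Set.mem_setOf_eq, Set.mem_univ_pi, Set.mem_Icc, abs_le]
    rw [this]
    exact isCompact_univ_pi fun _ => isCompact_Icc
  -- the local statement at every point of the square
  have hloc : ∀ p₀ ∈ {p : Fin 2 → ℝ | ∀ i, |p i| ≤ Real.pi}, ∀ᶠ z : ℕ × (Fin 2 → ℝ) in atTop ×ˢ 𝓝 p₀,
      |-2 * (Real.cos (z.2 0) + Real.cos (z.2 1)) - μ - ∑' q : ℕ × ℕ, cT z.1 q * TrigPolyC4v.harmonic q.1 q.2 z.2| ≤ Λ →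
      (v₁ ^ 2 ≤ gradSq (fun p : Fin 2 → ℝ => -2 * (Real.cos (p 0) + Real.cos (p 1)) - μ -
          ∑' q : ℕ × ℕ, cT z.1 q * TrigPolyC4v.harmonic q.1 q.2 p) z.2 ∧
        gradSq (fun p : Fin 2 → ℝ => -2 * (Real.cos (p 0) + Real.cos (p 1)) - μ -
          ∑' q : ℕ × ℕ, cT z.1 q * TrigPolyC4v.harmonic q.1 q.2 p) z.2 ≤ v₂ ^ 2) ∧
      (κ₁ ≤ |levelCurvature (fun p : Fin 2 → ℝ => -2 * (Real.cos (p 0) + Real.cos (p 1)) - μ -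
          ∑' q : ℕ × ℕ, cT z.1 q * TrigPolyC4v.harmonic q.1 q.2 p) z.2| ∧
        |levelCurvature (fun p : Fin 2 → ℝ => -2 * (Real.cos (p 0) + Real.cos (p 1)) - μ -
          ∑' q : ℕ × ℕ, cT z.1 q * TrigPolyC4v.harmonic q.1 q.2 p) z.2| ≤ κ₂) ∧
      ∀ v ∈ vanHovePoints, dv ^ 2 ≤ (z.2 0 - v 0) ^ 2 + (z.2 1 - v 1) ^ 2 := by
    intro p₀ hp₀
    obtain ⟨T0, TG, TK⟩ := tendsto_band_jets (c := cT) (cinf := fun q => κ q.1 q.2) hsT hκ htail μ p₀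
    by_cases hcase : |-2 * (Real.cos (p₀ 0) + Real.cos (p₀ 1)) - μ -
        ∑' q : ℕ × ℕ, κ q.1 q.2 * TrigPolyC4v.harmonic q.1 q.2 p₀| ≤ Λ
    · obtain ⟨⟨hg1, hg2⟩, ⟨hk1, hk2⟩, hvh⟩ := H p₀ hp₀ (by linarith)
      have hG : gradSq (fun p : Fin 2 → ℝ => -2 * (Real.cos (p 0) + Real.cos (p 1)) - μ -
          ∑' q : ℕ × ℕ, κ q.1 q.2 * TrigPolyC4v.harmonic q.1 q.2 p) p₀ ≠ 0 :=
        (lt_of_lt_of_le (by positivity) hg1).ne'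
      have TK' := (TK hG).abs
      have e1 := TG.eventually_const_lt (show v₁ ^ 2 < _ from lt_of_lt_of_le (by nlinarith) hg1)
      have e2 := TG.eventually_lt_const (show _ < v₂ ^ 2 from lt_of_le_of_lt hg2 (by nlinarith))
      have e3 := TK'.eventually_const_lt (show κ₁ < _ by linarith)
      have e4 := TK'.eventually_lt_const (show _ < κ₂ by linarith)
      have e5 : ∀ᶠ z : ℕ × (Fin 2 → ℝ) in atTop ×ˢ 𝓝 p₀, ∀ v ∈ vanHovePoints,
          dv ^ 2 < (z.2 0 - v 0) ^ 2 + (z.2 1 - v 1) ^ 2 := by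
        refine (eventually_all_finite vanHovePoints.finite_toSet).2 fun v hv => ?_
        have h2 : Tendsto (fun z : ℕ × (Fin 2 → ℝ) => z.2) (atTop ×ˢ 𝓝 p₀) (𝓝 p₀) := tendsto_snd
        have hc : Tendsto (fun z : ℕ × (Fin 2 → ℝ) => (z.2 0 - v 0) ^ 2 + (z.2 1 - v 1) ^ 2)
            (atTop ×ˢ 𝓝 p₀) (𝓝 ((p₀ 0 - v 0) ^ 2 + (p₀ 1 - v 1) ^ 2)) :=
          (((((continuous_apply 0).tendsto p₀).comp h2).sub_const (v 0)).pow 2).add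
            (((((continuous_apply 1).tendsto p₀).comp h2).sub_const (v 1)).pow 2)
        exact hc.eventually_const_lt (lt_of_lt_of_le (by nlinarith) (hvh v hv))
      filter_upwards [e1, e2, e3, e4, e5] with z h1 h2 h3 h4 h5
      exact fun _ => ⟨⟨h1.le, h2.le⟩, ⟨h3.le, h4.le⟩, fun v hv => (h5 v hv).le⟩
    · filter_upwards [T0.abs.eventually_const_lt (not_le.1 hcase)] with z hz
      exact fun hle => absurd hle (not_le.2 hz)
  -- compactness: a uniform threshold in `d`
  filter_upwards [eventually_forall_of_forall_eventually_prod hK hloc] with d hd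
  intro p hp hpΛ
  rw [hband d] at hpΛ ⊢
  exact hd p hp hpΛ

end Summit.HubbardSuperconductivity.CapRgSymmetricCertificatePinned.StrictContinuum
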